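import Summits.Ventures.PackingBounds.ThreePointCert.Soundness

/-!
# Trie-free residual checks for `(i')` and `(ii')`

Framing: lottery ticket; floor = certified bounds/negative ranges. Venture `PackingBounds`
(cell `pub-packcert`), three-point SDP family.

`checkI3` / `checkII3` of `ThreePointCert.Check` bound the residual of the two polynomial identities
with the trie-based `residualBound`; at n = 7, d = 12 that step sits at the edge of the kernel's
memory bound on the smaller farm nodes (the accepted `K7d12Proof` elaborates on the gate's node, not
on every node). `checkI3Z` / `checkII3Z` instead take `absSum` of the SORTED MERGE of the three term
lists (`mergeAll`, which already combines like monomials) and compare it with the slack — sound by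
`PolyCert.abs_eval_le` (`|eval p| ≤ absSum p` on the unit box) whatever the degree of combination.
`FII3_of_checkZ`, `AF3_of_checkZ`, `card_le_of_cert3Z` are the corresponding copies of the
soundness theorems of `ThreePointCert.Soundness` with only the first step changed.
-/

noncomputable section

open Finset
open scoped RealInnerProductSpace

namespace Summit.Ventures.PackingBounds.ThreePointCert

open Literature.Geometry.DiscreteGeometry Literature.Geometry.DiscreteGeometry.PolyCert
open Literature.Geometry.DiscreteGeometry.PolyCert.SPoly
open Literature.Analysis.SpecialFunctions

/-- Trie-free check of `(ii')`: `absSum` of the merged residual `target - rhs - c₀` is `≤ c₀`. -/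
def checkII3Z (c : Cert3) (P : CertPolys3) : Bool :=
  decide (absSum (mergeAll [targetII3 c P, neg (rhsII3 c P), neg (C (c.c0 : ℤ))]) ≤ c.c0)

/-- Trie-free check of `(i')`: `absSum` of the merged residual `target - rhs - c₀₁` is `≤ c₀₁`. -/
def checkI3Z (c : Cert3) (P : CertPolys3) : Bool :=
  decide (absSum (mergeAll [targetI3 c P, neg (rhsI3 c P), neg (C (c.c01 : ℤ))]) ≤ c.c01)

set_option maxHeartbeats 4000000 in
/-- Soundness of `(ii')` from the trie-free check: on `D'`, `F ≤ -b₂₂` (in units: `FvalG/D² ≤ -B22/(D²W)`). -/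
theorem FII3_of_checkZ (c : Cert3) (P : CertPolys3) {g0 g1 g2 g3 g4 q0 q1 : GramBlk}
    (hP : PolysOK3 c P g0 g1 g2 g3 g4 q0 q1) (h : checkII3Z c P = true) (hs : checkSide3 c = true)
    (u v t : ℝ)
    (hu : -1 ≤ u) (hu' : u ≤ (c.p : ℝ) / c.q) (hv : -1 ≤ v) (hv' : v ≤ (c.p : ℝ) / c.q)
    (ht : -1 ≤ t) (ht' : t ≤ (c.p : ℝ) / c.q)
    (hp : 0 ≤ 1 + 2 * u * v * t - u ^ 2 - v ^ 2 - t ^ 2) :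
    FvalG c.n c.F u v t / 2 ^ (2 * c.S) ≤ -((c.B22 : ℝ) / c.DDW) := by
  obtain ⟨hn, hq, hpq, _, hAlen, hFk, _⟩ := side_of_check c hs
  have hu1 := abs_le_one_of_box c.p c.q hq hpq u hu hu'
  have hv1 := abs_le_one_of_box c.p c.q hq hpq v hv hv'
  have ht1 := abs_le_one_of_box c.p c.q hq hpq t ht ht'
  have gu := gq_nonneg c.p c.q u hu (qmul_le_of_box c.p c.q hq u hu')
  have gv := gq_nonneg c.p c.q v hv (qmul_le_of_box c.p c.q hq v hv')
  have gt := gq_nonneg c.p c.q t ht (qmul_le_of_box c.p c.q hq t ht')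
  have hle : absSum (mergeAll [targetII3 c P, neg (rhsII3 c P), neg (C (c.c0 : ℤ))]) ≤ c.c0 := by
    unfold checkII3Z at h; exact of_decide_eq_true h
  have hres := (abs_eval_le _ hu1 hv1 ht1).trans (Nat.cast_le.2 hle)
  clear hle h
  rw [eval_mergeAll] at hres
  simp only [List.map_cons, List.map_nil, List.sum_cons, List.sum_nil, add_zero, eval_neg, eval_C,
    Int.cast_natCast] at hres
  have hrhs : 0 ≤ eval (rhsII3 c P) u v t := by
    have e0 := eval_nonneg_of_rvalid g0 P.E0 hP.h0 u v t hu1 hv1 ht1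
    have e1 := eval_nonneg_of_rvalid g1 P.E1 hP.h1 u v t hu1 hv1 ht1
    have e2 := eval_nonneg_of_rvalid g2 P.E2 hP.h2 u v t hu1 hv1 ht1
    have e3 := eval_nonneg_of_rvalid g3 P.E3 hP.h3 u v t hu1 hv1 ht1
    have e4 := eval_nonneg_of_rvalid g4 P.E4 hP.h4 u v t hu1 hv1 ht1
    rw [rhsII3, eval_mergeAll]
    simp only [List.map_cons, List.map_nil, List.sum_cons, List.sum_nil, add_zero, eval_mulN,
      eval_m1P, eval_m2P, eval_m3P, eval_p4]
    generalize eval P.E0 u v t = r0 at *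
    generalize eval P.E1 u v t = r1 at *
    generalize eval P.E2 u v t = r2 at *
    generalize eval P.E3 u v t = r3 at *
    generalize eval P.E4 u v t = r4 at *
    generalize (u + 1) * ((c.p : ℝ) - c.q * u) = a1 at *
    generalize (v + 1) * ((c.p : ℝ) - c.q * v) = a2 at *
    generalize (t + 1) * ((c.p : ℝ) - c.q * t) = a3 at *
    have m12 := mul_nonneg gu gv
    have m13 := mul_nonneg gu gt
    have m23 := mul_nonneg gv gt
    have m123 := mul_nonneg gu (mul_nonneg gv gt)
    nlinarith [mul_nonneg gu e1, mul_nonneg gv e1, mul_nonneg gt e1, mul_nonneg m12 e2,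
      mul_nonneg m13 e2, mul_nonneg m23 e2, mul_nonneg m123 e3, mul_nonneg hp e4]
  generalize hR : eval (rhsII3 c P) u v t = R at hres hrhs
  have htgt : 0 ≤ eval (targetII3 c P) u v t := by
    have h1 := (abs_le.1 hres).1
    linarith
  rw [targetII3, eval_neg, eval_append, eval_C, hP.hF u v t hu1 hv1 ht1,
    eval_FPolyG c.n c.d c.F hFk] at htgt
  push_cast at htgt
  have hW : (0 : ℝ) < Wfac c.d := by exact_mod_cast Wfac_pos c.d
  have hD : (0 : ℝ) < 2 ^ (2 * c.S) := pow_pos (by norm_num) _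
  have hDDW : (c.DDW : ℝ) = 2 ^ (2 * c.S) * (Wfac c.d : ℝ) := by simp [Cert3.DDW]
  have key : FvalG c.n c.F u v t * (Wfac c.d : ℝ) ≤ -(c.B22 : ℝ) := by linarith
  rw [hDDW, div_le_iff₀ hD]
  have e : -((c.B22 : ℝ) / (2 ^ (2 * c.S) * Wfac c.d)) * 2 ^ (2 * c.S) = -(c.B22 : ℝ) / Wfac c.d := by
    field_simp
  rw [e, le_div_iff₀ hW]
  exact key


set_option maxHeartbeats 4000000 in
/-- Soundness of `(i')` from the trie-free check: on `[-1, s]`, `A(u) + 3F(u,u,1) ≤ -1 - 2b₁₂ - b₂₂` (in units). -/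
theorem AF3_of_checkZ (c : Cert3) (P : CertPolys3) {g0 g1 g2 g3 g4 q0 q1 : GramBlk}
    (hP : PolysOK3 c P g0 g1 g2 g3 g4 q0 q1) (h : checkI3Z c P = true) (hs : checkSide3 c = true)
    (u : ℝ) (hu : -1 ≤ u) (hu' : u ≤ (c.p : ℝ) / c.q) :
    AvalG c.n c.A u / 2 ^ (2 * c.S) + 3 * (FvalG c.n c.F u u 1 / 2 ^ (2 * c.S)) ≤
      -1 - 2 * ((c.B12 : ℝ) / c.DDW) - (c.B22 : ℝ) / c.DDW := by
  obtain ⟨hn, hq, hpq, _, hAlen, hFk, _⟩ := side_of_check c hs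
  have hu1 := abs_le_one_of_box c.p c.q hq hpq u hu hu'
  have h01 : |(0 : ℝ)| ≤ 1 := by norm_num
  have h11 : |(1 : ℝ)| ≤ 1 := by norm_num
  have gu := gq_nonneg c.p c.q u hu (qmul_le_of_box c.p c.q hq u hu')
  have hle : absSum (mergeAll [targetI3 c P, neg (rhsI3 c P), neg (C (c.c01 : ℤ))]) ≤ c.c01 := by
    unfold checkI3Z at h; exact of_decide_eq_true h
  have hres := (abs_eval_le _ hu1 h01 h01).trans (Nat.cast_le.2 hle)
  clear hle h
  rw [eval_mergeAll] at hres
  simp only [List.map_cons, List.map_nil, List.sum_cons, List.sum_nil, add_zero, eval_neg, eval_C,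
    Int.cast_natCast] at hres
  have hrhs : 0 ≤ eval (rhsI3 c P) u 0 0 := by
    have e0 := eval_nonneg_of_rvalid q0 P.EQ0 hP.hq0 u 0 0 hu1 h01 h01
    have e1 := eval_nonneg_of_rvalid q1 P.EQ1 hP.hq1 u 0 0 hu1 h01 h01
    rw [rhsI3, eval_mergeAll]
    simp only [List.map_cons, List.map_nil, List.sum_cons, List.sum_nil, add_zero, eval_mulN,
      eval_gqU]
    nlinarith [mul_nonneg gu e1]
  generalize hR : eval (rhsI3 c P) u 0 0 = R at hres hrhs
  have htgt : 0 ≤ eval (targetI3 c P) u 0 0 := by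
    have h1 := (abs_le.1 hres).1
    linarith
  have hFss : eval (substUU1 P.FP) u 0 0 = (Wfac c.d : ℝ) * FvalG c.n c.F u u 1 := by
    rw [eval_substUU1, hP.hF u u 1 hu1 hu1 h11, eval_FPolyG c.n c.d c.F hFk]
  rw [targetI3, eval_neg, eval_append, eval_append, eval_C, eval_smul, hFss,
    eval_APolyG c.n c.d c.A hAlen.le] at htgt
  push_cast at htgt
  have hW : (0 : ℝ) < Wfac c.d := by exact_mod_cast Wfac_pos c.d
  have hD : (0 : ℝ) < 2 ^ (2 * c.S) := pow_pos (by norm_num) _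
  have hDDW : (c.DDW : ℝ) = 2 ^ (2 * c.S) * (Wfac c.d : ℝ) := by simp [Cert3.DDW]
  rw [hDDW] at htgt ⊢
  have hDW : (0 : ℝ) < 2 ^ (2 * c.S) * (Wfac c.d : ℝ) := mul_pos hD hW
  generalize hAv : AvalG c.n c.A u = AV at htgt ⊢
  generalize hFv : FvalG c.n c.F u u 1 = FV at htgt ⊢
  -- htgt : 0 ≤ -((2^(2S) W + 2 B12 + B22) + W AV + 3 (W FV))
  have key : (Wfac c.d : ℝ) * (AV + 3 * FV) ≤
      -(2 ^ (2 * c.S) * (Wfac c.d : ℝ)) - 2 * (c.B12 : ℝ) - (c.B22 : ℝ) := by linarith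
  have lhs_eq : AV / 2 ^ (2 * c.S) + 3 * (FV / 2 ^ (2 * c.S)) =
      ((Wfac c.d : ℝ) * (AV + 3 * FV)) / (2 ^ (2 * c.S) * Wfac c.d) := by
    field_simp
  have rhs_eq : -1 - 2 * ((c.B12 : ℝ) / (2 ^ (2 * c.S) * Wfac c.d)) - (c.B22 : ℝ) / (2 ^ (2 * c.S) * Wfac c.d)
      = (-(2 ^ (2 * c.S) * (Wfac c.d : ℝ)) - 2 * (c.B12 : ℝ) - (c.B22 : ℝ)) / (2 ^ (2 * c.S) * Wfac c.d) := by
    field_simp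
  rw [lhs_eq, rhs_eq]
  exact div_le_div_of_nonneg_right key hDW.le


/-- **The bound from a checked certificate**, trie-free variant of the two residual checks: (Bachoc–Vallentin Theorem 4.2, any `n ≥ 4`, angle
`s = p/q`): if the side conditions, the expansions, the two polynomial checks and the numerical
bound all pass, every finite set of unit vectors of `ℝⁿ` with pairwise inner products `≤ p/q` has
at most `N` elements. -/
theorem card_le_of_cert3Z (c : Cert3) (P : CertPolys3) {g0 g1 g2 g3 g4 q0 q1 : GramBlk}
    (hP : PolysOK3 c P g0 g1 g2 g3 g4 q0 q1) (hI : checkI3Z c P = true) (hII : checkII3Z c P = true)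
    (hs : checkSide3 c = true) (hb : checkBound3 c P = true)
    (C : Finset (EuclideanSpace ℝ (Fin c.n))) (hC : ∀ x ∈ C, ‖x‖ = 1)
    (hcode : ∀ x ∈ C, ∀ y ∈ C, x ≠ y → inner ℝ x y ≤ (c.p : ℝ) / c.q) : C.card ≤ c.N := by
  obtain ⟨hn, hq, hpq, _, hAlen, hFk, _⟩ := side_of_check c hs
  have hbd := bound3_of_check c P hP.hF hs hb
  have hD : (0 : ℝ) < 2 ^ (2 * c.S) := pow_pos (by norm_num) _
  have hA : 0 ≤ BachocVallentin.pairSum C (fun u => AvalG c.n c.A u / 2 ^ (2 * c.S)) := by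
    have h0 := pairSum_AvalG_nonneg (by omega : 3 ≤ c.n) c.A C hC
    unfold BachocVallentin.pairSum at h0 ⊢
    have e : (∑ x ∈ C, ∑ y ∈ C, AvalG c.n c.A (inner ℝ x y) / 2 ^ (2 * c.S)) =
        (∑ x ∈ C, ∑ y ∈ C, AvalG c.n c.A (inner ℝ x y)) / 2 ^ (2 * c.S) := by
      rw [Finset.sum_div]; refine Finset.sum_congr rfl fun x _ => ?_; rw [Finset.sum_div]
    rw [e]; exact div_nonneg h0 hD.le
  have hF : 0 ≤ BachocVallentin.tripleSum C (fun u v t => FvalG c.n c.F u v t / 2 ^ (2 * c.S)) := by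
    have h0 := tripleSum_FvalG_nonneg hn c.F C hC
    unfold BachocVallentin.tripleSum at h0 ⊢
    have e : (∑ x ∈ C, ∑ y ∈ C, ∑ z ∈ C,
        FvalG c.n c.F (inner ℝ x y) (inner ℝ x z) (inner ℝ y z) / 2 ^ (2 * c.S))
        = (∑ x ∈ C, ∑ y ∈ C, ∑ z ∈ C,
          FvalG c.n c.F (inner ℝ x y) (inner ℝ x z) (inner ℝ y z)) / 2 ^ (2 * c.S) := by
      rw [Finset.sum_div]; refine Finset.sum_congr rfl fun x _ => ?_
      rw [Finset.sum_div]; refine Finset.sum_congr rfl fun y _ => ?_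
      rw [Finset.sum_div]
    rw [e]; exact div_nonneg h0 hD.le
  have h := BachocVallentin.card_le_of_threePoint ((c.p : ℝ) / c.q) C hC hcode
    (fun u => AvalG c.n c.A u / 2 ^ (2 * c.S)) (fun u v t => FvalG c.n c.F u v t / 2 ^ (2 * c.S))
    ((c.B11 : ℝ) / c.DDW) ((c.B12 : ℝ) / c.DDW) ((c.B22 : ℝ) / c.DDW) hA hF
    (fun u v t => by rw [FvalG_swap12])
    (fun u v t => by rw [FvalG_swap23])
    (bquad3_nonneg_of_check c hs)
    (fun u hu hu' => AF3_of_checkZ c P hP hI hs u hu hu')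
    (fun u v t hu hu' hv hv' ht ht' hp => FII3_of_checkZ c P hP hII hs u v t hu hu' hv hv' ht ht' hp)
    hbd.2
  have hlt : (C.card : ℝ) < (c.N : ℝ) + 1 := lt_of_le_of_lt h hbd.1
  have hlt' : C.card < c.N + 1 := by exact_mod_cast hlt
  omega


end Summit.Ventures.PackingBounds.ThreePointCert

end
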